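import Summits.BirchSwinnertonDyer.BirchSwinnertonDyer.Theorems.GenusKolyvaginAtTwoMinimalTwinBSDTwoKrizLiAnchorWallSS
import Summits.BirchSwinnertonDyer.BirchSwinnertonDyer.Theorems.ByReductionTypeAtTwoAdditivePotGoodPrintKrizLi92b1Base
import Literature.NumberTheory.EllipticCurves.OrdinaryPrimesProofs
import Literature.NumberTheory.EllipticCurves.LeadingTermTamagawaProofs
import Literature.NumberTheory.EllipticCurves.HeegnerHypothesisKroneckerProofs
import Literature.NumberTheory.QuadraticFields.KroneckerSplitting
import Mathlib.Tactic.NormNum.LegendreSymbol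
import HarnessLib

/-!
# Route `GenusKolyvaginAtTwo`, crux U₂ `MinimalTwinBSDTwo` (stmt-BirchSwinnertonDyer-22985), LINE 23 «twin_swap»: THE WALL-KEYED KRIZ–LI ROAD AT THE
# RANK-ONE ANCHOR `91a1 = [0,0,1,1,0]` (`N = 91 = 7·13` square-free, `Δ = -91`, GOOD SUPERSINGULAR at `2` (`a₁ = 0`), `c₂ = 1`; Kriz–Li Table 1 row `91a1 | -55 | 1 | ✓`)
# OVER `K = ℚ(√-55)` (COMPOSITE `d_K = -55 = −5·11`: `K` is taken from the caller, as in the `124a1` road) — KERNEL BASE DATA (this file; the roads are in `…KrizLiAnchor91a1.lean`) for `BSD(·, 2)` on the whole packet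
# `{91a1^{(d)}, 91a1^{(-55d)} : d ∈ 𝒩(91a1, K), χ_d(−91) = 1}` from the PRINTED Table-1 row, Kriz–Li Thm 5.1 (2) / 4.3, Creutz–Miller on the base (`N = 91`) and
# EITHER WALL row 1 (§2) OR the SUPERSINGULAR wall row 19097 ALONE (§3) on the rank-zero companion `91a1^{(-55)}` (`N = 275275 > 5000`); witness `d = -31` (`91a1^{(-31)}`, rank 1, `N = 87451`)

Seat `bsd-line-gk2-p2` g35 (PROVER 2/3, cell `bsd-f1-sign2`; LINE 23 holder), `--supports stmt-BirchSwinnertonDyer-22985` (helper; closes nothing).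
THEOREMS ONLY (0 `def`, 0 `sorry`); standard axioms.  HONEST FRAMING (D-0014/D-0036): instance of the lineage's base-generic roads
`KrizLiAnchorWall.krizLi_bsdp_two_of_twist_of_conductor_lt_of_wall` (g34, `…KrizLiAnchorWall.lean`) and `…_of_ssWall` (g34, `…KrizLiAnchorWallSS.lean`) at
`V = 91a1` — one of the two Table-1 rows (`91a1`, `91b1`) the g34 waves left out because their Heegner field `ℚ(√−55)` has COMPOSITE discriminant (no
`sqrtField` constructor needed: every consumer has `K` in scope, so `r_an(91a1) = 1` is derived over the caller's `K`).  CONDITIONAL on displayed named facts: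
PRINT — Kriz–Li 2019 Thm 5.1 (2) (`thm112_bsdTwo_twist`), Thm 4.3 (`thm33_rank_twist`), the Table-1 row (`table1_row91a1`), Creutz–Miller / Miller
(`bsdTriple_of_analyticRank_le_one_of_conductor_lt` at `N = 91`), Gross–Zagier–Kolyvagin (`rank_eq_analyticRank_of_analyticRank_le_one`, for `r_an(91a1) = 1` from
Thm 4.3 + the kernel point) — and the RESEARCH input: §2 S1′ = WALL row 1 (`BSD₂` for every non-CM curve of analytic rank `0`, displayed as `hS1`), §3 the
SUPERSINGULAR wall row alone (item 19097 unfolded, displayed as `hSS`: `91a1` has `a₁ = 0`, so it and its companions by `d ≡ 1 (mod 4)` are good supersingular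
at `2`).  Kernel (§1): global minimality, `E[2]` irreducible (the `2`-division cubic `X³ + (0)X² + (16)X + (16)` has no root mod `5`), good
reduction at `2` with `c₂ = 1`, `GoodSS` at `2`, non-CM (multiplicative at `7` and `13`), `N = 91` exactly, the point `P = (−2/9, −10/27)` of infinite order (denominator
divisible by `3`), the Heegner hypothesis for `(91, -55)`, the witness `#Ẽ(𝔽_31) = 35` (`a_31 = -3` odd).
WHAT THIS SAYS FOR U₂: `rankOneMembers_91A1` / `rankOneMembers_91A1_of_ssWall` — at every global minimal `W₁ ≅ 91a1^{(d)}`, `d ∈ 𝒩`, `χ_d(−91) = 1`: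
`r_an(W₁) = 1 ∧ ¬CM ∧ BSDp W₁ 2` MODULO THE (supersingular) WALL + PRINT (no LINE 23 research stub).  Beyond-print theorem: no.  **BSD is NOT proved by any of
this; U₂ is NOT proved; the wall is OPEN; no item is closed.**  References: [KrizLi2019] Thm 5.1 (2), Thm 4.3, Def 4.1, §6 Ex. 6.2, Table 1 (row 91a1,
arXiv:1606.03172v3 Congruence.tex l. 974); [CreutzMiller2012] Thm 1.1; [Miller2011LMS] Def 1.1; [CremonaAlgorithms1997] Table 1 (91A1);
[SilvermanAEC2009] III.2.3, V.4, VII.1, VII.3.4, VII.5, X.5, App. C §11; [Kraus1989] Prop. 1–2; [Marcus1977] Ch. 3 Thm. 25.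
-/

set_option autoImplicit false
-- the Theorems namespace of this sub repeats the summit name by design (D-0017 nested layout)
set_option linter.dupNamespace false

noncomputable section

open scoped Classical NumberField

open WeierstrassCurve IsDedekindDomain Rat.HeightOneSpectrum NumberField Literature.NumberTheory.EllipticCurves
  Literature.NumberTheory.EllipticCurves.ModularForms
  Literature.NumberTheory.EllipticCurves.Rank1Residual
  Literature.NumberTheory.EllipticCurves.Rank1Residual.Typed
  Literature.NumberTheory.DiophantineGeometry
  Summit.BirchSwinnertonDyer
  Summit.BirchSwinnertonDyer.Rank1Residual
  Summit.BirchSwinnertonDyer.Rank1Residual.X11b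
  Summit.BirchSwinnertonDyer.Rank1Residual.X5.O1
  Summit.BirchSwinnertonDyer.Rank1Residual.P2
  Summit.BirchSwinnertonDyer.BirchSwinnertonDyer.Rank1Residual.IntModel
  Summit.BirchSwinnertonDyer.BirchSwinnertonDyer.Theorems
  Summit.BirchSwinnertonDyer.BirchSwinnertonDyer.Theorems.AddPotGoodPrint
  Summit.BirchSwinnertonDyer.BirchSwinnertonDyer.Theorems.OrdinaryTwistAtTwo
  Summit.BirchSwinnertonDyer.BirchSwinnertonDyer.Theorems.GenusExact.TwinSwap.KrizLiAnchorWall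

namespace Summit.BirchSwinnertonDyer.BirchSwinnertonDyer.Theorems.GenusExact.TwinSwap.KrizLiAnchor91a1

/-! ## §1 The anchor `91a1 = [0,0,1,1,0]`: `Δ = -91`, `c₄ = -48`, GOOD SUPERSINGULAR at `2`, multiplicative at `7` and `13` -/
section Base91A1

/-- `91a1` is an elliptic curve (`Δ = -91 ≠ 0`). [cite: CremonaAlgorithms1997, Table 1 (91A1)] -/
theorem isElliptic_91A1 : (⟨0, 0, 1, 1, 0⟩ : WeierstrassCurve ℚ).IsElliptic := ⟨by
  rw [isUnit_iff_ne_zero]; norm_num [WeierstrassCurve.Δ, WeierstrassCurve.b₂, WeierstrassCurve.b₄, WeierstrassCurve.b₆, WeierstrassCurve.b₈]⟩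

/-- `91a1` is GLOBALLY MINIMAL (`|Δ| = 7^1·13^1`: `v_p Δ < 12` everywhere). [cite: SilvermanAEC2009, VII.1 Remark 1.1] [cite: Kraus1989, Prop. 1 and Prop. 2] -/
theorem isGloballyMinimal_91A1 : (⟨0, 0, 1, 1, 0⟩ : WeierstrassCurve ℚ).IsGloballyMinimal :=
  isGloballyMinimal_of_krausCriterion_support (0) (0) (1) (1) (0) [(7, 0, 1), (13, 0, 1)]
    (by intro t ht; simp only [List.mem_cons, List.not_mem_nil, or_false] at ht
        rcases ht with rfl | rfl <;> norm_num)
    (by decide +kernel) (by decide +kernel)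

/-- `Δ(91a1) = -91` on the integer model. [cite: CremonaAlgorithms1997, Table 1 (91A1)] -/
theorem M91A1_Δ : (⟨0, 0, 1, 1, 0⟩ : WeierstrassCurve ℤ).Δ = -91 := by decide +kernel
/-- `c₄(91a1) = -48` on the integer model. [cite: CremonaAlgorithms1997, Table 1 (91A1)] -/
theorem M91A1_c₄ : (⟨0, 0, 1, 1, 0⟩ : WeierstrassCurve ℤ).c₄ = -48 := by decide +kernel
/-- The integer model of `91a1` is Cremona's. [cite: SilvermanAEC2009, VIII.8] -/
theorem intModel_91A1 :
    haveI := isElliptic_91A1; haveI := isGloballyMinimal_91A1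
    integralModelInt (⟨0, 0, 1, 1, 0⟩ : WeierstrassCurve ℚ) = (⟨0, 0, 1, 1, 0⟩ : WeierstrassCurve ℤ) :=
  haveI := isElliptic_91A1; haveI := isGloballyMinimal_91A1
  integralModelInt_eq_of_map_eq _ (by ext <;> simp [WeierstrassCurve.map])

/-- The integer model base-changed to `ℚ` is the rational model. [folklore] -/
theorem baseChange_int_91A1 : (⟨0, 0, 1, 1, 0⟩ : WeierstrassCurve ℤ).baseChange ℚ = (⟨0, 0, 1, 1, 0⟩ : WeierstrassCurve ℚ) := by
  ext <;> simp [WeierstrassCurve.baseChange, WeierstrassCurve.map]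

/-- `b₂, b₄, b₆` of `91a1`. [cite: SilvermanAEC2009, III.1] -/
theorem b_91A1 : (⟨0, 0, 1, 1, 0⟩ : WeierstrassCurve ℚ).b₂ = ((0 : ℤ) : ℚ) ∧ (⟨0, 0, 1, 1, 0⟩ : WeierstrassCurve ℚ).b₄ = ((2 : ℤ) : ℚ) ∧ (⟨0, 0, 1, 1, 0⟩ : WeierstrassCurve ℚ).b₆ = ((1 : ℤ) : ℚ) := by
  simp only [WeierstrassCurve.b₂, WeierstrassCurve.b₄, WeierstrassCurve.b₆]; norm_num

/-- **`E[2]` irreducible for `91a1`** (`E(ℚ)[2] = 0`): the monic `2`-division cubic `X³ + (0)X² + (16)X + (16)` has no root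
mod `5`. [cite: SilvermanAEC2009, III.2.3 (b)] [cite: KrizLi2019, Thm. 5.1 (hypothesis E(ℚ)[2] = 0)] -/
theorem irr_two_91A1 :
    haveI := isElliptic_91A1
    Irr (⟨0, 0, 1, 1, 0⟩ : WeierstrassCurve ℚ) 2 :=
  haveI := isElliptic_91A1
  irr_two_of_forall_cubic_ne _ b_91A1.1 b_91A1.2.1 b_91A1.2.2 (ℓ := 5) (by decide)

/-- **`E(ℚ)[2] = 0` for `91a1`** in Kriz–Li's shape. [cite: KrizLi2019, Thm. 5.1 hypothesis "E(ℚ)[2] = 0"] -/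
theorem twoTorsion_91A1 :
    haveI := isElliptic_91A1
    ∀ Q : (⟨0, 0, 1, 1, 0⟩ : WeierstrassCurve ℚ).toAffine.Point, 2 • Q = 0 → Q = 0 :=
  haveI := isElliptic_91A1
  (X5.O1.irr_two_iff_forall_two_nsmul _).mp irr_two_91A1

/-- **`91a1` has GOOD reduction at `2`** (`2 ∤ Δ_min = -91`). [cite: SilvermanAEC2009, VII.5 Prop. 5.1 (a)] [cite: KrizLi2019, §6 Table 1 (row 91a1: c₂ = 1)] -/
theorem hasGoodReductionAtPrime_two_91A1 :
    haveI := isGloballyMinimal_91A1; haveI : Fact (Nat.Prime 2) := ⟨Nat.prime_two⟩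
    (⟨0, 0, 1, 1, 0⟩ : WeierstrassCurve ℚ).HasGoodReductionAtPrime 2 := by
  haveI := isElliptic_91A1; haveI := isGloballyMinimal_91A1
  haveI : Fact (Nat.Prime 2) := ⟨Nat.prime_two⟩
  refine hasGoodReductionAtPrime_of_not_dvd _ 2 ?_
  rw [minimalDiscriminantInt_eq intModel_91A1, M91A1_Δ]; decide

/-- **`91a1` is good SUPERSINGULAR at `2`** (`a₁ = 0` on the minimal model: Kriz–Li's «formal group at `2` not `𝔾_m`», (★) ⟹ `a₂` even).
[cite: SilvermanAEC2009, V.4] [cite: KrizLi2019, §6 Example 6.2 and Table 1 (row 91a1)] -/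
theorem goodSS_two_91A1 :
    haveI := isGloballyMinimal_91A1; haveI : Fact (Nat.Prime 2) := ⟨Nat.prime_two⟩
    GoodSS (⟨0, 0, 1, 1, 0⟩ : WeierstrassCurve ℚ) 2 := by
  haveI := isElliptic_91A1; haveI := isGloballyMinimal_91A1
  exact goodSS_two_of_even_a₁ _ hasGoodReductionAtPrime_two_91A1 (by rw [intModel_91A1]; exact ⟨0, rfl⟩)

/-- **`c₂(91a1) = 1`** (good reduction: Tate's Step 1). [cite: SilvermanAEC2009, VII.2 remark after Prop. 2.1] [cite: KrizLi2019, §6 Table 1 (row 91a1: c₂ = 1)] -/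
theorem localTamagawaNumber_two_91A1 :
    haveI : Fact (Nat.Prime 2) := ⟨Nat.prime_two⟩
    ((⟨0, 0, 1, 1, 0⟩ : WeierstrassCurve ℚ).baseChange ℚ_[2]).localTamagawaNumber ℤ_[2] = 1 :=
  haveI := isGloballyMinimal_91A1
  haveI : Fact (Nat.Prime 2) := ⟨Nat.prime_two⟩
  localTamagawaNumber_padic_eq_one_of_good_holds _ 2 hasGoodReductionAtPrime_two_91A1

/-- **Kriz–Li's local hypotheses at `2` for `91a1`**: `c₂ = 1` odd and the Manin-constant clause VOID (good at `2`), for ANY parametrisation datum.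
[cite: KrizLi2019, Thm. 5.1 hypotheses "c₂(E) odd; Manin constant odd if additive at 2"] -/
theorem krizLi_loc_91A1
    [haveI := isElliptic_91A1; NeZero ((⟨0, 0, 1, 1, 0⟩ : WeierstrassCurve ℚ).conductorNorm ℤ)]
    (Dt : haveI := isElliptic_91A1; ModularParametrizationData (⟨0, 0, 1, 1, 0⟩ : WeierstrassCurve ℚ) ((⟨0, 0, 1, 1, 0⟩ : WeierstrassCurve ℚ).conductorNorm ℤ)) :
    haveI := isElliptic_91A1; haveI : Fact (2 : ℕ).Prime := ⟨Nat.prime_two⟩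
    Odd (((⟨0, 0, 1, 1, 0⟩ : WeierstrassCurve ℚ).baseChange ℚ_[2]).localTamagawaNumber ℤ_[2]) ∧
      (¬ (⟨0, 0, 1, 1, 0⟩ : WeierstrassCurve ℚ).HasGoodReductionAtPrime 2 → ¬ (⟨0, 0, 1, 1, 0⟩ : WeierstrassCurve ℚ).HasMultiplicativeReductionAtPrime 2 → Odd Dt.c) :=
  ⟨by rw [localTamagawaNumber_two_91A1]; exact odd_one, fun h _ => absurd hasGoodReductionAtPrime_two_91A1 h⟩

/-- **`91a1` is non-CM**: multiplicative at `7` (`7 ∣ Δ`, `7 ∤ c₄ = -48`), so `ord_7 j < 0` (`j = −2¹²·3³/91`). [cite: SilvermanAEC2009, App. C §11] -/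
theorem not_hasCM_91A1 :
    haveI := isElliptic_91A1
    ¬ (⟨0, 0, 1, 1, 0⟩ : WeierstrassCurve ℚ).HasCM := by
  haveI := isElliptic_91A1; haveI := isGloballyMinimal_91A1
  haveI : Fact (Nat.Prime 7) := ⟨by norm_num⟩
  exact AdditivePotMult.not_hasCM_of_padicValRat_j_neg (p := 7) (EisensteinPrimes.padicValRat_j_neg_of_mult _ 7
    (hasMultiplicativeReductionAtPrime_of_intModel intModel_91A1 7 (by rw [M91A1_Δ]; decide) (by rw [M91A1_c₄]; decide)))

/-- **`1 ≤ rank_ℤ 91a1(ℚ)` IN THE KERNEL**: the rational point `P = (−2/9, −10/27) = (-2 / 9, -10 / 27)` has `3` in its denominator, so it has infinite order (Silverman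
VII.3.4, tree `one_le_mordellWeilRank_of_dvd_den`). [cite: SilvermanAEC2009, VII.3.4 and Thm. VIII.6.7] [cite: CremonaAlgorithms1997, Table 1 (91A1: r = 1)] -/
theorem one_le_mordellWeilRank_91A1 :
    haveI := isElliptic_91A1; haveI := isGloballyMinimal_91A1
    1 ≤ (⟨0, 0, 1, 1, 0⟩ : WeierstrassCurve ℚ).mordellWeilRank :=
  haveI := isElliptic_91A1; haveI := isGloballyMinimal_91A1
  haveI : Fact (Nat.Prime 3) := ⟨by norm_num⟩
  one_le_mordellWeilRank_of_dvd_den (⟨0, 0, 1, 1, 0⟩ : WeierstrassCurve ℚ) 3 (by norm_num) (x := -2 / 9) (y := -10 / 27)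
    (WeierstrassCurve.Affine.equation_iff_nonsingular.mp (by rw [WeierstrassCurve.Affine.equation_iff]; norm_num))
    (by norm_num)

/-- **`N(91a1) ∣ |Δ_min| = 91`.** [cite: SilvermanAEC2009, VIII.11 and C.16] -/
theorem conductorNorm_dvd_91A1 :
    haveI := isElliptic_91A1
    (⟨0, 0, 1, 1, 0⟩ : WeierstrassCurve ℚ).conductorNorm ℤ ∣ 91 := by
  haveI := isElliptic_91A1; haveI := isGloballyMinimal_91A1
  have hdvd := WeierstrassCurve.conductorNorm_dvd_minimalDiscriminantNorm (⟨0, 0, 1, 1, 0⟩ : WeierstrassCurve ℚ)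
    (WeierstrassCurve.finite_setOf_ordMinimalDiscriminant_ne_zero_holds _)
  rw [WeierstrassCurve.minimalDiscriminantNorm_int_eq_natAbs_minimalDiscriminantInt_holds,
    minimalDiscriminantInt_eq intModel_91A1, M91A1_Δ] at hdvd
  exact hdvd

/-- **`ord_ℓ N(91a1) = 1` at `ℓ ∈ {7, 13}`** (multiplicative: `ℓ ∣ Δ`, `ℓ ∤ c₄`). [cite: Silverman1994, IV.11.1] -/
theorem factorization_conductorNorm_91A1 :
    haveI := isElliptic_91A1
    (((⟨0, 0, 1, 1, 0⟩ : WeierstrassCurve ℚ).conductorNorm ℤ).factorization 7 = 1) ∧ (((⟨0, 0, 1, 1, 0⟩ : WeierstrassCurve ℚ).conductorNorm ℤ).factorization 13 = 1) := by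
  haveI := isElliptic_91A1; haveI := isGloballyMinimal_91A1
  haveI hE : ((⟨0, 0, 1, 1, 0⟩ : WeierstrassCurve ℤ).baseChange ℚ).IsElliptic := by rw [baseChange_int_91A1]; infer_instance
  have key : ∀ (ℓ : ℕ) (hℓ : ℓ.Prime), (ℓ : ℤ) ∣ (⟨0, 0, 1, 1, 0⟩ : WeierstrassCurve ℤ).Δ → ¬ (ℓ : ℤ) ∣ (⟨0, 0, 1, 1, 0⟩ : WeierstrassCurve ℤ).c₄ → ((⟨0, 0, 1, 1, 0⟩ : WeierstrassCurve ℚ).conductorNorm ℤ).factorization ℓ = 1 := by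
    intro ℓ hℓ hΔ hc₄
    set v : HeightOneSpectrum ℤ := (primesEquiv (R := ℤ)).symm ⟨ℓ, hℓ⟩ with hv
    have hgen : natGenerator v = ℓ := congrArg Subtype.val ((primesEquiv (R := ℤ)).apply_symm_apply ⟨ℓ, hℓ⟩)
    have hmin : ((⟨0, 0, 1, 1, 0⟩ : WeierstrassCurve ℤ).baseChange ℚ).IsMinimalAt v := by
      rw [baseChange_int_91A1]; exact IsGloballyMinimal.isMinimalAt_int _ v
    have h1 : ((⟨0, 0, 1, 1, 0⟩ : WeierstrassCurve ℤ).baseChange ℚ).conductorExponent v = 1 :=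
      conductorExponent_eq_one_of_dvd_Δ_of_not_dvd_c₄ hmin (by rw [hgen]; exact hΔ) (by rw [hgen]; exact hc₄)
    rw [baseChange_int_91A1] at h1
    rw [show ℓ = ((⟨ℓ, hℓ⟩ : Nat.Primes) : ℕ) from rfl, factorization_conductorNorm_primesEquiv_symm]
    exact h1
  exact ⟨key 7 (by norm_num) (by rw [M91A1_Δ]; decide) (by rw [M91A1_c₄]; decide),
    key 13 (by norm_num) (by rw [M91A1_Δ]; decide) (by rw [M91A1_c₄]; decide)⟩

/-- The prime factorisation of `7ᵃ·13ᵇ`, read coefficientwise. [folklore] -/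
theorem factorization_7_pow_mul_13_pow_91A1 (a b r : ℕ) :
    (7 ^ a * 13 ^ b).factorization r = if r = 7 then a else if r = 13 then b else 0 := by
  have hp : Nat.Prime 7 := by norm_num
  have hq : Nat.Prime 13 := by norm_num
  rw [Nat.factorization_mul (pow_ne_zero _ hp.ne_zero) (pow_ne_zero _ hq.ne_zero), Finsupp.add_apply,
    Nat.factorization_pow, Nat.factorization_pow, Finsupp.smul_apply, Finsupp.smul_apply, hp.factorization, hq.factorization,
    Finsupp.single_apply, Finsupp.single_apply]
  by_cases hrp : r = 7
  · subst hrp; simp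
  by_cases hrq : r = 13
  · subst hrq; simp
  · simp [Ne.symm hrp, Ne.symm hrq, hrp, hrq]

/-- **`N(91a1) = 91 = 7·13` IN THE KERNEL** (`N ∣ 7^1·13^1`, `ord_7 N = ord_13 N = 1`). [cite: CremonaAlgorithms1997, Table 1 (91A1)] -/
theorem conductorNorm_91A1 :
    haveI := isElliptic_91A1
    (⟨0, 0, 1, 1, 0⟩ : WeierstrassCurve ℚ).conductorNorm ℤ = 91 := by
  haveI := isElliptic_91A1
  set M := (⟨0, 0, 1, 1, 0⟩ : WeierstrassCurve ℚ).conductorNorm ℤ with hM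
  have hM0 : M ≠ 0 := (conductorNorm_pos_holds _).ne'
  obtain ⟨hp1, hq1⟩ := factorization_conductorNorm_91A1
  have hle := (Nat.factorization_le_iff_dvd hM0 (by norm_num : (91 : ℕ) ≠ 0)).mpr conductorNorm_dvd_91A1
  have eN : (91 : ℕ) = 7 ^ 1 * 13 ^ 1 := by norm_num
  have eΔ : (91 : ℕ) = 7 ^ 1 * 13 ^ 1 := by norm_num
  refine Nat.eq_of_factorization_eq hM0 (by norm_num) fun r => ?_
  rw [eN, factorization_7_pow_mul_13_pow_91A1]
  by_cases hrp : r = 7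
  · subst hrp; rw [hp1]; simp
  by_cases hrq : r = 13
  · subst hrq; rw [hq1]; simp
  have hr' := hle r
  rw [eΔ, factorization_7_pow_mul_13_pow_91A1, if_neg hrp, if_neg hrq] at hr'
  rw [if_neg hrp, if_neg hrq]
  exact Nat.le_zero.mp hr'

/-- **`N(91a1) < 5000`** (Creutz–Miller's range). [cite: CreutzMiller2012, Thm. 1.1] -/
theorem conductorNorm_lt_5000_91A1 :
    haveI := isElliptic_91A1
    (⟨0, 0, 1, 1, 0⟩ : WeierstrassCurve ℚ).conductorNorm ℤ < 5000 := by
  rw [conductorNorm_91A1]; norm_num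

/-- **The Heegner hypothesis for `(91a1, K)`, `d_K = -55`**: the primes `7`, `13` of `N = 91` split in `K` (`(-55/7) = (-55/13) = 1`).
[cite: KrizLi2019, Thm. 5.1 hypothesis "K satisfies the Heegner hypothesis for N"] [cite: Marcus1977, Ch. 3 Thm. 25] -/
theorem satisfiesHeegnerHypothesis_91A1 {K : Type} [Field K] [NumberField K] (h2 : Module.finrank ℚ K = 2)
    (hdK : NumberField.discr K = -55) :
    haveI := isElliptic_91A1
    SatisfiesHeegnerHypothesis ((⟨0, 0, 1, 1, 0⟩ : WeierstrassCurve ℚ).conductorNorm ℤ) K := by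
  rw [conductorNorm_91A1, satisfiesHeegnerHypothesis_iff_kronecker _ K h2, hdK]
  intro r hr hrN
  have hrN' : r ∣ 7 * 13 := by norm_num at hrN ⊢; exact hrN
  rcases (Nat.Prime.dvd_mul hr).mp hrN' with h | h
  · obtain rfl := (Nat.prime_dvd_prime_iff_eq hr (by norm_num)).mp h
    exact ⟨fun h => absurd h (by norm_num), fun _ => by norm_num⟩
  · obtain rfl := (Nat.prime_dvd_prime_iff_eq hr (by norm_num)).mp h
    exact ⟨fun h => absurd h (by norm_num), fun _ => by norm_num⟩

/-- **`#Ẽ(𝔽_31) = 35` for `91a1`** (certified count), so `a_31 = -3`. [cite: SilvermanAEC2009, V.2] -/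
theorem reductionPointCount_31_91A1 :
    haveI := isGloballyMinimal_91A1
    (⟨0, 0, 1, 1, 0⟩ : WeierstrassCurve ℚ).reductionPointCount 31 = 35 := by
  haveI : Fact (Nat.Prime 31) := ⟨by norm_num⟩
  haveI := isElliptic_91A1; haveI := isGloballyMinimal_91A1
  exact Supersingular.reductionPointCount_eq_of_intModel_countPoints intModel_91A1 31 (by norm_num) (by decide +kernel)
    (by decide +kernel)

/-- **`a_31(91a1)` is odd** (`= -3`: `Frob_31` has order `3` on `E[2]`). [cite: KrizLi2019, Def. 4.1 ("Frob_ℓ of order 3")] -/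
theorem odd_frobeniusTrace_31_91A1 :
    haveI := isGloballyMinimal_91A1
    Odd ((⟨0, 0, 1, 1, 0⟩ : WeierstrassCurve ℚ).frobeniusTrace 31) := by
  haveI := isGloballyMinimal_91A1
  rw [Uniform.U2.odd_frobeniusTrace_iff_odd_reductionPointCount _ (by norm_num : Nat.Prime 31) (by norm_num),
    reductionPointCount_31_91A1]
  decide

end Base91A1

end Summit.BirchSwinnertonDyer.BirchSwinnertonDyer.Theorems.GenusExact.TwinSwap.KrizLiAnchor91a1

end
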